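import Literature.AlgebraicGeometry.Motives.WhiskerLeftPullback
import Mathlib.AlgebraicGeometry.Geometrically.Integral
import Mathlib.AlgebraicGeometry.Morphisms.ClosedImmersion
import Mathlib.RingTheory.Spectrum.Prime.Basic
import HarnessLib

/-!
# The prime strata of an affine base: `P ×_K Spec(A⧸𝔭) ↪ P ×_K T` (EGA III 6.10.5 / Mumford AV §5, set-up)

For `T` an affine `K`-scheme with ring `A = Γ(T, 𝒪_T)` and a prime `𝔭` of `A`, the **stratum**
`T_𝔭 = Spec(A⧸𝔭) → T → Spec K` is an affine integral `K`-scheme with a closed immersion `T_𝔭 ↪ T`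
(`Modules.stratum`, `Modules.stratumι`); for `P → Spec K` geometrically integral (flat, universally open)
and `A` noetherian the total space `P ×_K T_𝔭` is INTEGRAL (Görtz–Wedhorn I, Prop. 5.51) and
`P ×_K T_𝔭 ↪ P ×_K T` is a closed immersion (cartesian over `T_𝔭 ↪ T`, Görtz–Wedhorn I, Prop. 4.16;
★ `Motives/WhiskerLeftPullback.isPullback_whiskerLeft_snd`). The ring of `T_𝔭` is `A⧸𝔭` compatibly with
the structure maps (`stratumRingIso`, `stratumι_appTop_comp_stratumRingIso_hom`). This is the geometric
indexing of the noetherian dévissage of `Literature/Algebra/Homology/OrderedCechSystemDevissage`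
(Görtz–Wedhorn II, proof of Thm. 23.133, Step (I): induction over the quotients `A⧸𝔭`).
The scheme-property facts (`IsAffine`, `IsIntegral`, `IsLocallyNoetherian`, `IsClosedImmersion`,
`IsAffineHom` of the stratum and its maps) are typeclass INSTANCES, as in Mathlib's `AlgebraicGeometry`
and the ★ `Modules/*` files, so that downstream files find them by instance search. Everything is proved;
no named facts. Mathlib searched (pin): `IsClosedImmersion.spec_of_surjective`, `Scheme.ΓSpecIso_naturality`,
`GeometricallyIntegral` (used). Cell `hodgecm-mathlib`, M13 node N1 (1a-γ) (B-p10 (g8), cut/couriered by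
B-p15 (g8) per B-plan1 R140); generic, books 0.

## References

* U. Görtz, T. Wedhorn, *Algebraic Geometry I: Schemes*, 2nd ed. (2020), Prop. 4.16 (p. 101); Prop. 5.51
  (p. 139). [GortzWedhorn2020]
* U. Görtz, T. Wedhorn, *Algebraic Geometry II: Cohomology of Schemes* (2023),
  doi:10.1007/978-3-658-43031-3: Thm. 23.133, proof, Step (I) (p. 354). [GortzWedhorn2023]
* A. Grothendieck, EGA III₂ (Publ. Math. IHÉS 17, 1963), (6.10.5). [EGA3]
* D. Mumford, *Abelian Varieties*, TIFR Studies in Mathematics 5 (1970), §5. [MumfordAV1970]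
-/

universe u

open CategoryTheory CategoryTheory.Limits AlgebraicGeometry TopologicalSpace Opposite MonoidalCategory
open CartesianMonoidalCategory
open Literature.AlgebraicGeometry.Motives

set_option backward.isDefEq.respectTransparency false

noncomputable section

namespace Literature.AlgebraicGeometry.Modules

variable {K : Type u} [Field K] (T : SchemeOver K) [IsAffine T.left]

/-! ### The stratum `T_𝔭 = Spec(A⧸𝔭)` -/

section Stratum

variable (𝔭 : PrimeSpectrum Γ(T.left, ⊤))

/-- The quotient map `A → A⧸𝔭` in `CommRingCat`. [folklore] [cite: GortzWedhorn2023, Thm. 23.133, proof, Step (I) (p. 354)] -/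
abbrev quotHom : Γ(T.left, ⊤) ⟶ CommRingCat.of (Γ(T.left, ⊤) ⧸ 𝔭.asIdeal) :=
  CommRingCat.ofHom (Ideal.Quotient.mk 𝔭.asIdeal)

/-- The morphism `Spec(A⧸𝔭) → T` (`T` affine with ring `A`). [folklore] [cite: GortzWedhorn2023, Thm. 23.133, proof, Step (I) (p. 354)] -/
def stratumToBase : Spec (CommRingCat.of (Γ(T.left, ⊤) ⧸ 𝔭.asIdeal)) ⟶ T.left :=
  Spec.map (quotHom T 𝔭) ≫ T.left.isoSpec.inv

/-- **The stratum `T_𝔭 = Spec(A⧸𝔭)` as a `K`-scheme** (through `T`). [folklore] [cite: GortzWedhorn2023, Thm. 23.133, proof, Step (I) (p. 354)] -/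
def stratum : SchemeOver K := Over.mk (stratumToBase T 𝔭 ≫ T.hom)

/-- The structure morphism `T_𝔭 ⟶ T` over `K`. [folklore] [cite: GortzWedhorn2023, Thm. 23.133, proof, Step (I) (p. 354)] -/
def stratumι : stratum T 𝔭 ⟶ T := Over.homMk (stratumToBase T 𝔭) rfl

/-- The underlying scheme of the stratum is `Spec(A⧸𝔭)`. [folklore] [cite: GortzWedhorn2023, Thm. 23.133, proof, Step (I) (p. 354)] -/
@[simp] theorem stratum_left : (stratum T 𝔭).left = Spec (CommRingCat.of (Γ(T.left, ⊤) ⧸ 𝔭.asIdeal)) := rfl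

/-- The underlying morphism of `stratumι`. [folklore] [cite: GortzWedhorn2023, Thm. 23.133, proof, Step (I) (p. 354)] -/
@[simp] theorem stratumι_left : (stratumι T 𝔭).left = stratumToBase T 𝔭 := rfl

/-- The stratum is affine. [folklore] [cite: GortzWedhorn2023, Thm. 23.133, proof, Step (I) (p. 354)] -/
instance isAffine_stratum_left : IsAffine (stratum T 𝔭).left :=
  inferInstanceAs (IsAffine (Spec _))

/-- The stratum is integral (`A⧸𝔭` is a domain). [folklore] [cite: GortzWedhorn2023, Thm. 23.133, proof, Step (I) (p. 354)] -/
instance isIntegral_stratum_left : IsIntegral (stratum T 𝔭).left := by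
  change IsIntegral (Spec (CommRingCat.of (Γ(T.left, ⊤) ⧸ 𝔭.asIdeal)))
  infer_instance

/-- The stratum is locally noetherian when `A` is noetherian. [folklore] [cite: GortzWedhorn2023, Thm. 23.133, proof, Step (I) (p. 354)] -/
instance isLocallyNoetherian_stratum_left [IsNoetherianRing Γ(T.left, ⊤)] :
    IsLocallyNoetherian (stratum T 𝔭).left := by
  change IsLocallyNoetherian (Spec (CommRingCat.of (Γ(T.left, ⊤) ⧸ 𝔭.asIdeal)))
  infer_instance

/-- `T_𝔭 ↪ T` is a closed immersion. [folklore] [cite: GortzWedhorn2023, Thm. 23.133, proof, Step (I) (p. 354)] -/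
instance isClosedImmersion_stratumToBase : IsClosedImmersion (stratumToBase T 𝔭) := by
  unfold stratumToBase
  haveI : IsClosedImmersion (Spec.map (quotHom T 𝔭)) :=
    IsClosedImmersion.spec_of_surjective _ Ideal.Quotient.mk_surjective
  infer_instance

/-- `(stratumι).left` is a closed immersion. [folklore] [cite: GortzWedhorn2023, Thm. 23.133, proof, Step (I) (p. 354)] -/
instance isClosedImmersion_stratumι_left : IsClosedImmersion (stratumι T 𝔭).left :=
  isClosedImmersion_stratumToBase T 𝔭

/-! ### The ring of the stratum is `A⧸𝔭` -/

/-- The ring isomorphism `Γ(T_𝔭, 𝒪) ≅ A⧸𝔭` (Mathlib `Scheme.ΓSpecIso`). [folklore] [cite: GortzWedhorn2023, Thm. 23.133, proof, Step (I) (p. 354)] -/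
def stratumRingIso : Γ((stratum T 𝔭).left, ⊤) ≅ CommRingCat.of (Γ(T.left, ⊤) ⧸ 𝔭.asIdeal) :=
  Scheme.ΓSpecIso _

/-- **The structure map `A → Γ(T_𝔭, 𝒪)` followed by `Γ(T_𝔭, 𝒪) ≅ A⧸𝔭` is the quotient map.** [folklore] [cite: GortzWedhorn2023, Thm. 23.133, proof, Step (I) (p. 354)] -/
theorem stratumι_appTop_comp_stratumRingIso_hom :
    (stratumι T 𝔭).left.appTop ≫ (stratumRingIso T 𝔭).hom = quotHom T 𝔭 := by
  rw [stratumι_left, stratumToBase, Scheme.Hom.comp_appTop, Category.assoc, stratumRingIso,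
    Scheme.ΓSpecIso_naturality, ← Category.assoc]
  have h : T.left.isoSpec.inv.appTop ≫ (Scheme.ΓSpecIso Γ(T.left, ⊤)).hom = 𝟙 _ := by
    rw [← Scheme.toSpecΓ_appTop, ← Scheme.Hom.comp_appTop, Scheme.isoSpec, asIso_inv,
      IsIso.hom_inv_id, Scheme.Hom.id_appTop]
  rw [h, Category.id_comp]

/-- Elementwise form: `e(ι♯ a) = a mod 𝔭`. [folklore] [cite: GortzWedhorn2023, Thm. 23.133, proof, Step (I) (p. 354)] -/
theorem stratumRingIso_hom_appTop (a : Γ(T.left, ⊤)) :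
    (stratumRingIso T 𝔭).hom ((stratumι T 𝔭).left.appTop a) = Ideal.Quotient.mk 𝔭.asIdeal a := by
  have := congrArg (fun φ => φ a) (congrArg CommRingCat.Hom.hom (stratumι_appTop_comp_stratumRingIso_hom T 𝔭))
  simpa using this

end Stratum

/-! ### The total space of a stratum -/

section Total

variable (P : SchemeOver K) (𝔭 : PrimeSpectrum Γ(T.left, ⊤))

/-- **`P ×_K T_𝔭` is integral** for `P` geometrically integral, flat and universally open over `K` and
`A` noetherian (Görtz–Wedhorn I, Prop. 5.51; Mathlib `GeometricallyIntegral.isIntegral_of_isLocallyNoetherian`).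
[cite: GortzWedhorn2020, Prop. 5.51 (p. 139)] -/
instance isIntegral_tensorObj_stratum_left [GeometricallyIntegral P.hom] [Flat P.hom] [UniversallyOpen P.hom]
    [IsNoetherianRing Γ(T.left, ⊤)] : IsIntegral (P ⊗ stratum T 𝔭).left :=
  inferInstanceAs (IsIntegral (pullback P.hom (stratum T 𝔭).hom))

/-- **`P ×_K T_𝔭 ↪ P ×_K T` is a closed immersion** (base change of `T_𝔭 ↪ T` along `P ×_K T → T`,
★ `isPullback_whiskerLeft_snd`). [cite: GortzWedhorn2020, Prop. 4.16 (p. 101)] -/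
instance isClosedImmersion_whiskerLeft_stratumι_left : IsClosedImmersion (P ◁ stratumι T 𝔭).left :=
  MorphismProperty.of_isPullback (P := @IsClosedImmersion)
    (isPullback_whiskerLeft_snd P (stratumι T 𝔭)).flip inferInstance

/-- `P ×_K T_𝔭 ↪ P ×_K T` is affine. [folklore] [cite: GortzWedhorn2023, Thm. 23.133, proof, Step (I) (p. 354)] -/
instance isAffineHom_whiskerLeft_stratumι_left : IsAffineHom (P ◁ stratumι T 𝔭).left :=
  inferInstance

/-- Preimages of affine opens under `P ×_K T_𝔭 ↪ P ×_K T` are affine. [folklore] [cite: GortzWedhorn2023, Thm. 23.133, proof, Step (I) (p. 354)] -/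
theorem isAffineOpen_preimage_whiskerLeft_stratumι {U : (P ⊗ T).left.Opens} (hU : IsAffineOpen U) :
    IsAffineOpen ((P ◁ stratumι T 𝔭).left ⁻¹ᵁ U) :=
  hU.preimage _

end Total

end Literature.AlgebraicGeometry.Modules

end


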